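/- LEAD seat `ym-line-cbag-p1` (prover-ym-line-cbag-p1-g23-0), LINE 7 `GlueballBandRecursion`: the ONE object to which the line's three cruxes
K1 ⟨stmt-QuantumFields-27508⟩, K2 ⟨27507⟩, K3′ ⟨27554⟩ reduce — an effective one-particle Bloch symbol family on the strong-coupling window
(blueprint v4 §7 on 27554).  Definition only (route-posited object, reviewed); consumed by Theorems/GlueballBandRecursionRungOfBlochSymbol.lean.
Route-independent (no `Theses` import). -/
import Summits.QuantumFields.YangMills.Theorems.GlueballBandRecursionOneGlueballBandDichotomyBandTopFlat
import Literature.MathematicalPhysics.QuantumFieldTheory.Balaban1983to89.InfiniteVolumeSufficientXII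
import Literature.MathematicalPhysics.QuantumFieldTheory.YangMillsOS

/-!
# Route `GlueballBandRecursion`: the effective one-particle Bloch symbol family (the consolidated XL target P1)

`EffectiveBlochSymbolFamily` packages, for every compact `G` and faithful unitary lattice representation `r`, with constants `K, n₀, D', L₀`
uniform on the strong-coupling window `0 ≤ β ≤ strongCouplingRadius r.ρ`, and for each `β` either the rank-one escape (`q_N = 0` for all
`N ≥ L₀`: trivial group, `β = 0`) or a log-rate `ℓ = ℓ(β)` and, for every spatial period `N ≥ L₀`, a `2π`-periodic Hermitian matrix symbol
`B̃_N : ℝ³ → Herm_n(ℂ)` (`1 ≤ n ≤ n₀`: orientations × species of the one-plaquette multiplet) such that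
* (positivity and log-C²) every Rayleigh quotient `R_u(q) = Re⟪u, B̃_N(q) u⟫` of a unit vector is positive with second differences of its
  logarithm `≤ K|v|²`;
* (attained supremum, volume-stable) the supremum `Λ_N` of the Rayleigh quotients is attained and `|log Λ_N − ℓ| ≤ D'/N`
  (the torus glueball mass has a volume limit — in truth with exponentially small corrections);
* (two-sided trace control) `½·Σ_p Re tr B̃_N(θp)^{m+2} ≤ traceExcess r.ρ β N (m+2) ≤ 2·Σ_p Re tr B̃_N(θp)^{m+2}` for all large `m` AND at the
  crux time `N/4 = m + 2` (`θp = latticeAngle N p` the lattice angles; the Bloch blocks carry the cold thermal trace — Borgs–Imbrie-type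
  effective-matrix statement for the EXCITED one-plaquette band).
This is the finite-torus, β-uniform one-particle theorem of the strong-coupling transfer matrix in the clothes a cluster-expansion proof
produces (template: Borgs–Imbrie, CMP 145 (1992) Thm A, for ground-state multiplets; the one-particle side: Schor 1983/84, Bricmont–Fröhlich
1985–87, Faria da Veiga–O'Carroll 2026 — all in infinite volume).  It is NOT proved anywhere; `Theorems/GlueballBandRecursionRungOfBlochSymbol.lean`
proves that it implies K1 ∧ K2 ∧ K3′ and hence the rung `ColdDoublingRecursionStrongCoupling`.

HONEST FRAMING.  A definition; nothing is proved here, in particular not the Yang–Mills mass gap.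
-/

set_option autoImplicit false

noncomputable section

open scoped InnerProductSpace
open Literature.MathematicalPhysics.QuantumFieldTheory
open Literature.MathematicalPhysics.QuantumFieldTheory.Balaban1983to89.Missing (strongCouplingRadius)

namespace Summit.QuantumFields.YangMills.Theorems.GlueballBandRecursion.Band

/-- **The effective one-particle Bloch symbol family** (see the module docstring): per `(G, r)` uniform constants `K ≥ 0`, `n₀`, `D' ≥ 0`,
`L₀`; per `β` on the window either `q_N = 0` for all `N ≥ L₀`, or a log-rate `ℓ` and per `N ≥ L₀` a periodic Hermitian symbol with positive
log-C² Rayleigh quotients, an attained volume-stable supremum, and two-sided control of the cold thermal trace by its Bloch blocks at all large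
Euclidean times and at the crux time `⌊N/4⌋`. -/
def EffectiveBlochSymbolFamily : Prop :=
  ∀ (G : Type) [Group G] [TopologicalSpace G] [IsTopologicalGroup G] [CompactSpace G],
    letI : MeasurableSpace G := borel G
    haveI : BorelSpace G := ⟨rfl⟩
    ∀ r : LatticeRep G, ∃ K : ℝ, 0 ≤ K ∧ ∃ n₀ : ℕ, ∃ D' : ℝ, 0 ≤ D' ∧ ∃ L₀ : ℕ,
      ∀ β : ℝ, 0 ≤ β → β ≤ strongCouplingRadius r.ρ →
        (∀ (N : ℕ) [NeZero N], L₀ ≤ N →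
          (⨅ k : ℕ, traceExcess r.ρ β N (k + 2) ^ ((1 : ℝ) / ((k : ℝ) + 2))) = 0) ∨
        ∃ ℓ : ℝ, ∀ (N : ℕ) [NeZero N], L₀ ≤ N →
          ∃ (n : ℕ) (_ : 0 < n) (_ : n ≤ n₀) (Bt : (Fin 3 → ℝ) → Matrix (Fin n) (Fin n) ℂ)
            (_ : ∀ q, (Bt q).IsHermitian),
            (∀ (q : Fin 3 → ℝ) (z : Fin 3 → ℤ), Bt (fun i => q i + 2 * Real.pi * z i) = Bt q) ∧
            (∀ u : EuclideanSpace ℂ (Fin n), ‖u‖ = 1 →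
              (∀ q, 0 < RCLike.re ⟪u, Matrix.toEuclideanLin (Bt q) u⟫_ℂ) ∧
              ∀ x v : Fin 3 → ℝ,
                2 * Real.log (RCLike.re ⟪u, Matrix.toEuclideanLin (Bt x) u⟫_ℂ) - K * ∑ i, v i ^ 2 ≤
                  Real.log (RCLike.re ⟪u, Matrix.toEuclideanLin (Bt (x + v)) u⟫_ℂ) +
                    Real.log (RCLike.re ⟪u, Matrix.toEuclideanLin (Bt (x - v)) u⟫_ℂ)) ∧
            (∃ (Λ : ℝ) (qs : Fin 3 → ℝ) (us : EuclideanSpace ℂ (Fin n)), ‖us‖ = 1 ∧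
              RCLike.re ⟪us, Matrix.toEuclideanLin (Bt qs) us⟫_ℂ = Λ ∧
              (∀ (q : Fin 3 → ℝ) (u : EuclideanSpace ℂ (Fin n)), ‖u‖ = 1 →
                RCLike.re ⟪u, Matrix.toEuclideanLin (Bt q) u⟫_ℂ ≤ Λ) ∧
              |Real.log Λ - ℓ| ≤ D' / (N : ℝ)) ∧
            (∃ m₀ : ℕ, ∀ m : ℕ, (m₀ ≤ m ∨ N / 4 = m + 2) →
              (1 / 2 : ℝ) * ∑ p : Fin N × Fin N × Fin N, ((Bt (latticeAngle N p) ^ (m + 2)).trace).re ≤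
                  traceExcess r.ρ β N (m + 2) ∧
              traceExcess r.ρ β N (m + 2) ≤
                2 * ∑ p : Fin N × Fin N × Fin N, ((Bt (latticeAngle N p) ^ (m + 2)).trace).re)

end Summit.QuantumFields.YangMills.Theorems.GlueballBandRecursion.Band

end
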